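import Summits.RiemannHypothesis.RiemannHypothesis.Theorems.HandoffUpperClauses
import Summits.RiemannHypothesis.RiemannHypothesis.Theorems.SemilocalNegCertThirteen
import Summits.RiemannHypothesis.RiemannHypothesis.Theorems.SemilocalNegCertSeventeen
import Summits.RiemannHypothesis.RiemannHypothesis.Theorems.SemilocalNegCertNineteen
import Summits.RiemannHypothesis.RiemannHypothesis.Theorems.SemilocalNegCertTwentyThreeLight
import Summits.RiemannHypothesis.RiemannHypothesis.Theorems.SemilocalNegCertTwentyNineLight
import Summits.RiemannHypothesis.RiemannHypothesis.Theorems.SemilocalNegCertUptoThirtyOne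
import Summits.RiemannHypothesis.RiemannHypothesis.Theorems.SemilocalNegCertUptoThirtySeven
import Summits.RiemannHypothesis.RiemannHypothesis.Theorems.SemilocalNegCertUptoFortyOne
import Summits.RiemannHypothesis.RiemannHypothesis.Theorems.SemilocalNegCertUptoFortyThree
import Summits.RiemannHypothesis.RiemannHypothesis.Theorems.SemilocalNegCertUptoFortySeven
import Summits.RiemannHypothesis.RiemannHypothesis.Theorems.SemilocalNegCertUptoFiftyThree
import Summits.RiemannHypothesis.RiemannHypothesis.Theorems.SemilocalNegCertUptoFiftyNine
import Summits.RiemannHypothesis.RiemannHypothesis.Theorems.SemilocalNegCertUptoSixtyOneFinal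
import Summits.RiemannHypothesis.RiemannHypothesis.Theorems.SemilocalNegCertUptoSixtySeven
import Summits.RiemannHypothesis.RiemannHypothesis.Theorems.SemilocalNegCertUptoSeventyOne
import Summits.RiemannHypothesis.RiemannHypothesis.Theorems.SemilocalNegCertUptoSeventyThree
import Summits.RiemannHypothesis.RiemannHypothesis.Theorems.SemilocalClassLawLeaves
import HarnessLib

/-!
# C-I(a) — the kernel HEAD in LEAF currency: `SemilocalClassLawHead` (the law at every prime `q < 80`) PROVED from the wall certificates, WITHOUT importing `SemilocalClassLaw.lean` (RH-FREE; CENSUS — NOBODY APPENDS TO THIS MODULE)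

RH-FREE (LADDER-RH column WEIL, PROOF-OF-DATA target (P2) C-I(a); cell `rh-explicit`; D-0059/D-0061 route «WeilSemilocal» of planner weil-routes-1).
WHY THIS MODULE (director-rh I l.7233/l.7245, 2026-08-25): the single-file `SemilocalClassLaw.lean` (p402719 + appends) proved the head
`semilocalClassLawBelow_eighty` but is census-heavy for the hub build lane and cannot be split in place (the gate's `theorems.append-only` forbids
removing declarations).  This module proves THE SAME HEAD in the currency of the route's leaf file `SemilocalClassLawLeaves.lean` (p405674) —
the conjunct of `semilocalClassLawAll_iff_head_and_tail` — importing ONLY the wall-certificate modules and the leaf file (all built), so that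
the route's Head support item, its `closes` glue and every downstream file can avoid importing `SemilocalClassLaw.lean` altogether.  It is
elaborated ONCE and never appended to: new wall rows go to NEW sibling modules.
HONEST FRAMING: upper clauses about the tree's semi-local thresholds of TRUNCATED Weil forms; nothing here bears on the truth of RH.

* `SemilocalClassLawHead` — the closed constant «the law at every prime `q < 80`» (= the head conjunct of `semilocalClassLawAll_iff_head_and_tail`,
  definitionally `SemilocalClassLawBelow 80` of `SemilocalClassLaw.lean`);
* `semilocalClassLawHead_holds : SemilocalClassLawHead` — from the 22 kernel wall certificates (cc-s2-4 `SemilocalNegCert*`; `q ≤ 13` via theory-2's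
  `HandoffUpperClauses`; `q = 59, 71` by the tree enclosures of `log 61`, `log 73`);
* `semilocalClassLawAll_of_tail'` — the ROUTE ASSEMBLY in leaf currency: `SemilocalClassLawTail → SemilocalClassLawAll`, and `semilocalClassLawAll_iff_tail'`.
References: H. Yoshida, Adv. Stud. Pure Math. 21 (1992) Prop. 6 p. 320 (`Yoshida1992HermitianForms`); A. Connes, C. Consani, Enseign. Math. 69 (2023)
§2.1.2 (`ConnesConsani2023`).
-/

set_option linter.dupNamespace false  -- the mandated namespace repeats `RiemannHypothesis`

noncomputable section

open Set Literature.NumberTheory.LFunctions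
open Summit.RiemannHypothesis.RiemannHypothesis.Theorems
open Summit.RiemannHypothesis.RiemannHypothesis.Theorems.HandoffDecomposition
open Summit.RiemannHypothesis.RiemannHypothesis.Theorems.HandoffUpperClauses
open Summit.RiemannHypothesis.RiemannHypothesis.Theorems.MotivicDoor.SemilocalThreshold
open Summit.RiemannHypothesis.RiemannHypothesis.Theorems.SemilocalPolyWitness

namespace Summit.RiemannHypothesis.RiemannHypothesis.Theorems.SemilocalClassLaw

/-- **The HEAD of C-I(a) as one closed constant**: the law at every prime `q < 80` (∀q′ currency of the leaf file). [this cell, HOME/STRUCTURE.md §2 C-I(a)] -/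
def SemilocalClassLawHead : Prop :=
  ∀ q : ℕ, q.Prime → q < 80 → ∀ q' : ℕ, q'.Prime → q < q' → weilSemilocalThreshold (Nat.primesBelow q) < Real.log q' / 2

/-- Sufficient form at one prime: no prime strictly between `q` and `Q` and `a*(S_q) < (log Q)/2` give the clause for every prime `q' > q`. [folklore] -/
theorem head_clause_of_lt {q Q : ℕ} (hQ : ∀ m : ℕ, q < m → m < Q → ¬ m.Prime)
    (hlt : weilSemilocalThreshold (Nat.primesBelow q) < Real.log Q / 2) :
    ∀ q' : ℕ, q'.Prime → q < q' → weilSemilocalThreshold (Nat.primesBelow q) < Real.log q' / 2 := by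
  intro q' hq' hqq'
  have hQq' : Q ≤ q' := by
    by_contra h
    exact hQ q' hqq' (not_le.1 h) hq'
  rcases Nat.eq_zero_or_pos Q with rfl | hQ0
  · simp only [Nat.cast_zero, Real.log_zero, zero_div] at hlt
    exact absurd hlt (not_lt.2 (weilSemilocalThreshold_pos _).le)
  · have h1 : (Q : ℝ) ≤ q' := by exact_mod_cast hQq'
    have h0 : (0 : ℝ) < Q := by exact_mod_cast hQ0
    linarith [Real.log_le_log h0 h1]

/-- The same with the literal finset of the certificate's statement. [folklore] -/
theorem head_clause_of_eq {q Q : ℕ} {T : Finset ℕ} (hT : Nat.primesBelow q = T) (hQ : ∀ m : ℕ, q < m → m < Q → ¬ m.Prime)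
    (hlt : weilSemilocalThreshold T < Real.log Q / 2) :
    ∀ q' : ℕ, q'.Prime → q < q' → weilSemilocalThreshold (Nat.primesBelow q) < Real.log q' / 2 :=
  head_clause_of_lt hQ (hT ▸ hlt)

/-- **THE HEAD HOLDS (RH-free, kernel)**: C-I(a) at every prime `q < 80`, from the 22 wall certificates. [this cell, HOME/STRUCTURE.md §2 C-I(a); tree certificates `SemilocalNegCert*`, `HandoffUpperClauses`] -/
theorem semilocalClassLawHead_holds : SemilocalClassLawHead := by
  intro q hq hlt
  have hmem : q ∈ Nat.primesBelow 80 := Nat.mem_primesBelow.2 ⟨hlt, hq⟩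
  rw [show Nat.primesBelow 80 = {2, 3, 5, 7, 11, 13, 17, 19, 23, 29, 31, 37, 41, 43, 47, 53, 59, 61, 67, 71, 73, 79} from by decide] at hmem
  simp only [Finset.mem_insert, Finset.mem_singleton] at hmem
  obtain rfl | rfl | rfl | rfl | rfl | rfl | rfl | rfl | rfl | rfl | rfl | rfl | rfl | rfl | rfl | rfl | rfl | rfl | rfl | rfl |
    rfl | rfl := hmem
  · exact head_clause_of_lt (Q := 3) (fun m h1 h2 ↦ by omega) weilSemilocalThreshold_primesBelow_two_lt
  · exact head_clause_of_lt (Q := 5) (fun m h1 h2 ↦ by interval_cases m; decide) weilSemilocalThreshold_primesBelow_three_lt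
  · exact head_clause_of_lt (Q := 7) (fun m h1 h2 ↦ by interval_cases m; decide) weilSemilocalThreshold_primesBelow_five_lt
  · exact head_clause_of_lt (Q := 11) (fun m h1 h2 ↦ by interval_cases m <;> decide) weilSemilocalThreshold_primesBelow_seven_lt
  · exact head_clause_of_lt (Q := 13) (fun m h1 h2 ↦ by interval_cases m; decide) weilSemilocalThreshold_primesBelow_eleven_lt
  · exact head_clause_of_lt (Q := 17) (fun m h1 h2 ↦ by interval_cases m <;> decide) weilSemilocalThreshold_primesBelow_thirteen_lt
  · exact head_clause_of_eq (Q := 18) (by decide) (fun m h1 h2 ↦ by omega) weilSemilocalThreshold_uptoThirteen_lt_log_eighteen_half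
  · exact head_clause_of_eq (Q := 20) (by decide) (fun m h1 h2 ↦ by omega) weilSemilocalThreshold_uptoSeventeen_lt_log_twenty_half
  · exact head_clause_of_eq (Q := 24) (by decide) (fun m h1 h2 ↦ by omega) weilSemilocalThreshold_uptoNineteen_lt_log_twentyfour_half
  · exact head_clause_of_eq (Q := 30) (by decide) (fun m h1 h2 ↦ by omega) weilSemilocalThreshold_uptoTwentyThree_lt_log_thirty_half
  · exact head_clause_of_eq (Q := 32) (by decide) (fun m h1 h2 ↦ by omega) weilSemilocalThreshold_uptoTwentyNine_lt_log_thirtytwo_half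
  · exact head_clause_of_eq (Q := 40) (by decide) (fun m h1 h2 ↦ by interval_cases m <;> decide) weilSemilocalThreshold_uptoThirtyOne_lt_log_forty_half
  · exact head_clause_of_eq (Q := 43) (by decide) (fun m h1 h2 ↦ by interval_cases m; decide) weilSemilocalThreshold_uptoThirtySeven_lt_log_fortythree_half
  · exact head_clause_of_eq (Q := 46) (by decide) (fun m h1 h2 ↦ by interval_cases m <;> decide) weilSemilocalThreshold_uptoFortyOne_lt_log_fortysix_half
  · exact head_clause_of_eq (Q := 50) (by decide) (fun m h1 h2 ↦ by interval_cases m <;> decide) weilSemilocalThreshold_uptoFortyThree_lt_log_fifty_half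
  · exact head_clause_of_eq (Q := 56) (by decide) (fun m h1 h2 ↦ by interval_cases m <;> decide) weilSemilocalThreshold_uptoFortySeven_lt_log_fiftysix_half
  · refine head_clause_of_lt (Q := 61) (fun m h1 h2 ↦ by interval_cases m; decide) ?_
    rw [show Nat.primesBelow 59 = {2, 3, 5, 7, 11, 13, 17, 19, 23, 29, 31, 37, 41, 43, 47, 53} from by decide]
    have h := weilSemilocalThreshold_uptoFiftyThree_le
    have hl := logSixtyOneLo_le
    rw [logSixtyOneLo] at hl
    push_cast at h hl
    linarith
  · exact head_clause_of_eq (Q := 65) (by decide) (fun m h1 h2 ↦ by interval_cases m <;> decide) weilSemilocalThreshold_uptoFiftyNine_lt_log_sixtyfive_half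
  · exact head_clause_of_eq (Q := 71) (by decide) (fun m h1 h2 ↦ by interval_cases m <;> decide) weilSemilocalThreshold_uptoSixtyOne_lt_log_seventyone_half
  · refine head_clause_of_lt (Q := 73) (fun m h1 h2 ↦ by interval_cases m; decide) ?_
    rw [show Nat.primesBelow 71 = {2, 3, 5, 7, 11, 13, 17, 19, 23, 29, 31, 37, 41, 43, 47, 53, 59, 61, 67} from by decide]
    have h := weilSemilocalThreshold_uptoSixtySeven_le
    have hl := logSeventyThreeLo_le
    rw [logSeventyThreeLo] at hl
    push_cast at h hl
    linarith
  · exact head_clause_of_eq (Q := 78) (by decide) (fun m h1 h2 ↦ by interval_cases m <;> decide) weilSemilocalThreshold_uptoSeventyOne_lt_log_seventyeight_half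
  · exact head_clause_of_eq (Q := 83) (by decide) (fun m h1 h2 ↦ by interval_cases m <;> decide) weilSemilocalThreshold_uptoSeventyThree_lt_log_eightythree_half

/-- The head IS the first conjunct of `semilocalClassLawAll_iff_head_and_tail`. [folklore] -/
theorem semilocalClassLawAll_iff_head_and_tail' : SemilocalClassLawAll ↔ SemilocalClassLawHead ∧ SemilocalClassLawTail :=
  semilocalClassLawAll_iff_head_and_tail

/-- **ROUTE ASSEMBLY in leaf currency (no import of `SemilocalClassLaw.lean`)**: the crux implies the leaf — `SemilocalClassLawTail → SemilocalClassLawAll`. [this cell, HOME/STRUCTURE.md §2 C-I(a)] -/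
theorem semilocalClassLawAll_of_tail' (h : SemilocalClassLawTail) : SemilocalClassLawAll :=
  semilocalClassLawAll_iff_head_and_tail.2 ⟨semilocalClassLawHead_holds, h⟩

/-- … hence leaf ⟺ crux. [folklore] -/
theorem semilocalClassLawAll_iff_tail' : SemilocalClassLawAll ↔ SemilocalClassLawTail :=
  ⟨fun h ↦ (semilocalClassLawAll_iff_head_and_tail.1 h).2, semilocalClassLawAll_of_tail'⟩

end Summit.RiemannHypothesis.RiemannHypothesis.Theorems.SemilocalClassLaw

end
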